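import Literature.Computability.QuantumComplexity.OracleSubstitution
import Literature.Computability.QuantumComplexity.TidyBlockWeighted
import HarnessLib

/-!
# Substituting subroutines for oracle gates: the error along the ideal trajectory

Topic `Literature/Computability/QuantumComplexity`, a corollary file of `OracleSubstitution.lean`
(`OracleImpl.substGates`: every oracle gate of a gate list is replaced by a block, its ancillas on
fresh wires; `OracleImpl.implOn_substGates`: blocks within `ε` of the query gate in OPERATOR norm give
a substituted circuit within `numOracle · ε`) and of `TidyBlockWeighted.lean` (the weighted form of BBBV's Thm. 4.14 for the tidy block of a decider).
For subroutines whose quality depends on the query — Regev's iterative step (Regev 2009, Lemma 3.3),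
where the `CVP` oracle of the quantum sampler of Lemma 3.14 is the classical procedure of Lemma 3.4,
right with high probability over the input samples for each query separately but not uniformly —
the operator-norm hypothesis is not available, and one needs the form of the hybrid argument in
which the error of each substituted block is measured ON THE STATE OF THE IDEAL RUN at that gate
(Bennett–Bernstein–Brassard–Vazirani 1997, proof of Thm. 3.3: `|φ_T⟩ − |φ'_T⟩ = Σ_i U_T ⋯ U_{i+1}|E_i⟩`
with `|E_i⟩` the error made at step `i` on the IDEAL state `|φ_i⟩`, and `‖U‖ ≤ 1`; Bernstein–Vazirani
1997, §6; Nielsen–Chuang 2010, Box 4.1). This file proves it in the tree's model: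

* `OracleImpl.blockErr`, `OracleImpl.trajErr` — the error of the placed block of an oracle gate on a
  given state, and the sum of these errors along the ideal trajectory of a gate list (the state before
  each oracle gate being the state of the run WITH the oracle `A`, transported to the ambient register);
* **`OracleImpl.l2Norm_substGates_sub_le`** — `‖S ψ − (U^A ⊗ 1) ψ‖₂ ≤ trajErr ψ` on clean inputs
  (telescoping; the substituted tail is a contraction);
* for the tidy blocks of deciders (BBBV Thm. 4.14), the block error on a clean state is at most
  `2 √(Σ_q errProb(q) · w(q))` with `w(q)` the weight of the query `q` in that state
  (`OracleImpl.placedQueryWeight`, `normSq_placeGate_tidyCirc_sub_le`, `blockErr_tidy_le`, from the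
  weighted form of Thm. 4.14, `TidyBlock.normSq_tidyCirc_sub_ideal_le` of `TidyBlockWeighted.lean`), whence
  **`OracleImpl.l2Norm_substGates_tidy_sub_le`**: `‖S ψ − (U^A ⊗ 1) ψ‖₂ ≤ Σ_t 2√(Σ_q ε_t(q) w_t(q))`, the
  sum over the oracle gates `t` of the list, `w_t` the query weights of the ideal run at gate `t`
  (`OracleImpl.tidyTrajBound`).

Everything is proved; no named fact is introduced.

## References

* C. H. Bennett, E. Bernstein, G. Brassard, U. Vazirani, *Strengths and weaknesses of quantum
  computing*, SIAM J. Comput. 26 (1997) 1510–1523, Thm. 3.3 (proof: hybrid argument), Thm. 4.14,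
  Cor. 4.15 [BennettBernsteinBrassardVazirani1997].
* E. Bernstein, U. Vazirani, *Quantum complexity theory*, SIAM J. Comput. 26 (1997), §6
  (accumulation of errors) [BernsteinVazirani1997].
* M. A. Nielsen, I. L. Chuang, *Quantum Computation and Quantum Information*, CUP 2010, §4.5.3
  Box 4.1 [NielsenChuang2010].
* O. Regev, *On lattices, learning with errors, random linear codes, and cryptography*, J. ACM 56
  (2009), art. 34, Lemmas 3.3, 3.4, 3.14 [Regev2009].
-/

noncomputable section

namespace Literature.Computability.QuantumComplexity

open Cryptography Matrix

namespace OracleImpl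

variable {G : QGateSet} {N W : ℕ}

/-! ### The error of the substitution along the ideal trajectory -/

section Traj

/-- **The error of the placed block of an oracle gate `oracle k e` on the state `ψ`** (fresh wires
from `off`): `‖B ψ − (U_A ⊗ 1) ψ‖₂` (and `0` if the block does not fit, a case excluded below).
[cite: BennettBernsteinBrassardVazirani1997, Thm. 3.3 (proof: the error vector |E_i⟩)] -/
def blockErr (B : OracleImpl G) (hNW : N ≤ W) (A A' : Language Bool) {k : ℕ} (e : Fin (k + 1) ↪ Fin N)
    (off : ℕ) (ψ : QReg W → ℂ) : ℝ :=
  if h : N ≤ off ∧ off + B.anc k ≤ W then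
    l2Norm ((⟨(mapWires (blockEmb e off (B.anc k) h.1 h.2) (B.circ k)).gates⟩ : QCircuit G W).toMatrix A' *ᵥ ψ -
      placeGate (e.trans (Fin.castLEEmb hNW)) (oracleGate A k) *ᵥ ψ)
  else 0

/-- The block error is nonnegative. [folklore] -/
theorem blockErr_nonneg (B : OracleImpl G) (hNW : N ≤ W) (A A' : Language Bool) {k : ℕ} (e : Fin (k + 1) ↪ Fin N)
    (off : ℕ) (ψ : QReg W → ℂ) : 0 ≤ blockErr B hNW A A' e off ψ := by
  unfold blockErr
  split_ifs
  · exact l2Norm_nonneg _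
  · exact le_rfl

/-- **The error of the substitution along the ideal trajectory**: the sum, over the oracle gates of
the list, of the error of their placed blocks on the state of the IDEAL run (with the oracle `A`,
transported to the ambient register) just before that gate.
[cite: BennettBernsteinBrassardVazirani1997, Thm. 3.3 (proof)] -/
def trajErr (B : OracleImpl G) (hNW : N ≤ W) (A A' : Language Bool) : ℕ → List (QGate G N) → (QReg W → ℂ) → ℝ
  | _, [], _ => 0
  | off, QGate.gate s e :: gs, ψ => trajErr B hNW A A' off gs (placeGate (e.trans (Fin.castLEEmb hNW)) (G.mat s) *ᵥ ψ)
  | off, QGate.oracle k e :: gs, ψ => blockErr B hNW A A' e off ψ +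
      trajErr B hNW A A' (off + B.anc k) gs (placeGate (e.trans (Fin.castLEEmb hNW)) (oracleGate A k) *ᵥ ψ)

/-- `l2Norm 0 = 0`. [folklore] -/
theorem l2Norm_zero' {M : ℕ} : l2Norm (0 : QReg M → ℂ) = 0 := by
  rw [l2Norm_eq_sqrt_normSq]
  simp [Cryptography.normSq]

variable (hG : G.IsUnitary)
include hG

/-- **The hybrid argument for substituted subroutines** (BBBV Thm. 3.3 / Cor. 4.15 with the error
measured on the ideal run): on clean inputs, the substituted circuit differs from the original oracle
circuit (idle on the fresh wires) by at most the sum of the block errors along the ideal trajectory: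
`S_T⋯S_1ψ − U_T⋯U_1ψ = Σ_t S_T⋯S_{t+1}(S_t − U_t)U_{t-1}⋯U_1ψ` and the `S` are contractions.
[cite: BennettBernsteinBrassardVazirani1997, Thm. 3.3 (proof) and Cor. 4.15] [cite: BernsteinVazirani1997, §6] -/
theorem l2Norm_substGates_sub_le (B : OracleImpl G) (hNW : N ≤ W) (A A' : Language Bool) :
    ∀ (gs : List (QGate G N)) (off : ℕ), N ≤ off → off + extra B gs ≤ W →
      ∀ ψ : QReg W → ℂ, SuppIn (CleanAbove N W) ψ →
        l2Norm ((⟨substGates B hNW off gs⟩ : QCircuit G W).toMatrix A' *ᵥ ψ -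
          placeGate (Fin.castLEEmb hNW) ((⟨gs⟩ : QCircuit G N).toMatrix A) *ᵥ ψ) ≤ trajErr B hNW A A' off gs ψ
  | [], off, _, _, ψ, _ => by
    simp only [substGates, QCircuit.toMatrix_nil, placeGate_one, trajErr, Matrix.one_mulVec, sub_self, l2Norm_zero']
    exact le_rfl
  | QGate.gate s e :: gs, off, hoff, hW, ψ, hψ => by
    have hψ' : SuppIn (CleanAbove N W) (placeGate (e.trans (Fin.castLEEmb hNW)) (G.mat s) *ᵥ ψ) :=
      preservesSupp_cleanAbove_placeGate hNW e _ ψ hψ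
    have ih := l2Norm_substGates_sub_le B hNW A A' gs off hoff hW _ hψ'
    simp only [substGates, QCircuit.toMatrix_cons, trajErr]
    rw [placeGate_mul_holds, toMatrix_mapWiresGate, QGate.toMatrix_gate, QGate.toMatrix_gate, placeGate_placeGate,
      ← Matrix.mulVec_mulVec, ← Matrix.mulVec_mulVec]
    exact ih
  | QGate.oracle k e :: gs, off, hoff, hW, ψ, hψ => by
    have hW' : off + (B.anc k + extra B gs) ≤ W := by simpa only [extra] using hW
    have hfit : N ≤ off ∧ off + B.anc k ≤ W := ⟨hoff, by omega⟩
    have hψ' : SuppIn (CleanAbove N W) (placeGate (e.trans (Fin.castLEEmb hNW)) (oracleGate A k) *ᵥ ψ) :=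
      preservesSupp_cleanAbove_placeGate hNW e _ ψ hψ
    have ih := l2Norm_substGates_sub_le B hNW A A' gs (off + B.anc k) (by omega) (by omega) _ hψ'
    simp only [substGates, dif_pos hfit, QCircuit.toMatrix_cons, trajErr, blockErr]
    rw [toMatrix_mk_append, placeGate_mul_holds, QGate.toMatrix_oracle, placeGate_placeGate, ← Matrix.mulVec_mulVec,
      ← Matrix.mulVec_mulVec]
    set S := (⟨substGates B hNW (off + B.anc k) gs⟩ : QCircuit G W).toMatrix A' with hS
    set M := (⟨(mapWires (blockEmb e off (B.anc k) hfit.1 hfit.2) (B.circ k)).gates⟩ : QCircuit G W).toMatrix A' with hM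
    set U := placeGate (e.trans (Fin.castLEEmb hNW)) (oracleGate A k) with hU
    set V := placeGate (Fin.castLEEmb hNW) ((⟨gs⟩ : QCircuit G N).toMatrix A) with hV
    calc l2Norm (S *ᵥ (M *ᵥ ψ) - V *ᵥ (U *ᵥ ψ))
        ≤ l2Norm (S *ᵥ (M *ᵥ ψ) - S *ᵥ (U *ᵥ ψ)) + l2Norm (S *ᵥ (U *ᵥ ψ) - V *ᵥ (U *ᵥ ψ)) := l2Norm_sub_le _ _ _
      _ ≤ l2Norm (M *ᵥ ψ - U *ᵥ ψ) + trajErr B hNW A A' (off + B.anc k) gs (U *ᵥ ψ) :=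
          add_le_add (by rw [← Matrix.mulVec_sub]; exact isContraction_toMatrix hG A' _ _) ih

end Traj

/-! ### Tidy blocks of deciders: the block error is a weighted sum of the decider's errors -/

section Tidy

variable {k d : ℕ}

/-- **The weight of the query `q` at a placed tidy block** in the state `ψ` of the ambient register:
the sum over the fibres of the placement of the weights of `q` (for a state clean on the block's
ancillas: the total squared amplitude of the basis states whose query wires read `q`).
[cite: BennettBernsteinBrassardVazirani1997, Def. 3.2] -/
def placedQueryWeight (E : Fin (TidyBlock.W k d) ↪ Fin W) (ψ : QReg W → ℂ) (q : QReg k) : ℝ :=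
  ∑ r, TidyBlock.queryWeight (placeFibre E ψ r) q

/-- Placed query weights are nonnegative. [folklore] -/
theorem placedQueryWeight_nonneg (E : Fin (TidyBlock.W k d) ↪ Fin W) (ψ : QReg W → ℂ) (q : QReg k) :
    0 ≤ placedQueryWeight E ψ q :=
  Finset.sum_nonneg fun _ _ => TidyBlock.queryWeight_nonneg _ q

/-- **The weighted Thm. 4.14 transported along a placement**: fibrewise, then the fibres are summed.
[cite: BennettBernsteinBrassardVazirani1997, Thm. 4.14 (proof)] [cite: NielsenChuang2010, §4.3] -/
theorem normSq_placeGate_tidyCirc_sub_le (A : Language Bool) (D : QCircuit cliffordT (k + d))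
    (E : Fin (TidyBlock.W k d) ↪ Fin W) (ψ : QReg W → ℂ)
    (hψ : SuppIn {z : QReg W | z ∘ E ∈ {y : QReg (TidyBlock.W k d) | ∀ i : Fin (TidyBlock.W k d), k + 1 ≤ (i : ℕ) → y i = false}} ψ) :
    normSq (placeGate E (TidyBlock.tidyCirc D).mat *ᵥ ψ - placeGate E (TidyBlock.ideal A k d) *ᵥ ψ) ≤
      4 * ∑ q, TidyBlock.errProb A D q * placedQueryWeight E ψ q := by
  rw [normSq_eq_sum_normSq_placeFibre E]
  calc ∑ r, normSq (placeFibre E (placeGate E (TidyBlock.tidyCirc D).mat *ᵥ ψ - placeGate E (TidyBlock.ideal A k d) *ᵥ ψ) r)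
      = ∑ r, normSq ((TidyBlock.tidyCirc D).mat *ᵥ placeFibre E ψ r - TidyBlock.ideal A k d *ᵥ placeFibre E ψ r) := by
        simp_rw [placeFibre_sub, placeFibre_placeGate_mulVec]
    _ ≤ ∑ r, 4 * ∑ q, TidyBlock.errProb A D q * TidyBlock.queryWeight (placeFibre E ψ r) q :=
        Finset.sum_le_sum fun r _ => TidyBlock.normSq_tidyCirc_sub_ideal_le A D _ (suppIn_placeFibre E hψ r)
    _ = 4 * ∑ q, TidyBlock.errProb A D q * placedQueryWeight E ψ q := by
        rw [← Finset.mul_sum, Finset.sum_comm]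
        simp_rw [placedQueryWeight, Finset.mul_sum]

/-- **The tidy blocks of a decider assignment** `D k` (on `k + d k` wires): blocks `tidyCirc (D k)`
with `k + d k` ancillas. [cite: BennettBernsteinBrassardVazirani1997, Thm. 4.14] -/
def tidyImpl {dd : ℕ → ℕ} (D : (k : ℕ) → QCircuit cliffordT (k + dd k)) : OracleImpl cliffordT where
  anc k := k + dd k
  circ k := TidyBlock.tidyCirc (D k)

/-- **The block error of a tidy block on a clean state is at most `2√(Σ_q errProb(q)·w(q))`.**
[cite: BennettBernsteinBrassardVazirani1997, Thm. 4.14 (proof)] -/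
theorem blockErr_tidy_le {dd : ℕ → ℕ} (D : (k : ℕ) → QCircuit cliffordT (k + dd k)) (hD : ∀ k, (D k).IsOracleFree)
    (hNW : N ≤ W) (A A' : Language Bool) {k : ℕ} (e : Fin (k + 1) ↪ Fin N) {off : ℕ} (hoff : N ≤ off)
    (hfit : off + (k + dd k) ≤ W) (ψ : QReg W → ℂ) (hψ : SuppIn (CleanAbove N W) ψ) :
    blockErr (tidyImpl D) hNW A A' e off ψ ≤
      2 * Real.sqrt (∑ q, TidyBlock.errProb A (D k) q * placedQueryWeight (blockEmb e off (k + dd k) hoff hfit) ψ q) := by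
  have hfit' : N ≤ off ∧ off + (tidyImpl D).anc k ≤ W := ⟨hoff, hfit⟩
  rw [blockErr, dif_pos hfit']
  set E := blockEmb e off (k + dd k) hoff hfit with hE
  have hideal : placeGate (e.trans (Fin.castLEEmb hNW)) (oracleGate A k) = placeGate E (TidyBlock.ideal A k (dd k)) := by
    rw [placeGate_placeGate, castAddEmb_trans_blockEmb]
  have hmat : (⟨(mapWires E (TidyBlock.tidyCirc (D k))).gates⟩ : QCircuit cliffordT W).toMatrix A' =
      placeGate E (TidyBlock.tidyCirc (D k)).mat := by
    rw [show (⟨(mapWires E (TidyBlock.tidyCirc (D k))).gates⟩ : QCircuit cliffordT W) = mapWires E (TidyBlock.tidyCirc (D k)) from rfl,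
      toMatrix_mapWires, QCircuit.toMatrix_eq_of_isOracleFree (TidyBlock.tidyCirc_isOracleFree (hD k)) A' 0]
  change l2Norm ((⟨(mapWires E (TidyBlock.tidyCirc (D k))).gates⟩ : QCircuit cliffordT W).toMatrix A' *ᵥ ψ -
      placeGate (e.trans (Fin.castLEEmb hNW)) (oracleGate A k) *ᵥ ψ) ≤ _
  rw [hmat, hideal, l2Norm_eq_sqrt_normSq]
  have hψE : SuppIn {z : QReg W | z ∘ E ∈ {y : QReg (TidyBlock.W k (dd k)) | ∀ i : Fin (TidyBlock.W k (dd k)), k + 1 ≤ (i : ℕ) → y i = false}} ψ :=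
    hψ.mono (cleanAbove_subset_comp_blockEmb e off _ hoff hfit)
  have h := normSq_placeGate_tidyCirc_sub_le A (D k) E ψ hψE
  have h4 : Real.sqrt (4 * ∑ q, TidyBlock.errProb A (D k) q * placedQueryWeight E ψ q) =
      2 * Real.sqrt (∑ q, TidyBlock.errProb A (D k) q * placedQueryWeight E ψ q) := by
    rw [Real.sqrt_mul (by norm_num : (0 : ℝ) ≤ 4), show Real.sqrt 4 = 2 by
      rw [show (4 : ℝ) = 2 ^ 2 by norm_num, Real.sqrt_sq zero_le_two]]
  rw [← h4]
  exact Real.sqrt_le_sqrt h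

/-- **The bound along the ideal trajectory for tidy blocks**: the same recursion as `trajErr` with
each block error replaced by `2√(Σ_q errProb(q)·w(q))`.
[cite: BennettBernsteinBrassardVazirani1997, Thm. 3.3 (proof) with Thm. 4.14] -/
def tidyTrajBound {dd : ℕ → ℕ} (D : (k : ℕ) → QCircuit cliffordT (k + dd k)) (hNW : N ≤ W) (A : Language Bool) :
    ℕ → List (QGate cliffordT N) → (QReg W → ℂ) → ℝ
  | _, [], _ => 0
  | off, QGate.gate s e :: gs, ψ =>
      tidyTrajBound D hNW A off gs (placeGate (e.trans (Fin.castLEEmb hNW)) (cliffordT.mat s) *ᵥ ψ)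
  | off, QGate.oracle k e :: gs, ψ =>
      (if h : N ≤ off ∧ off + (k + dd k) ≤ W then
        2 * Real.sqrt (∑ q, TidyBlock.errProb A (D k) q * placedQueryWeight (blockEmb e off (k + dd k) h.1 h.2) ψ q)
       else 0) +
      tidyTrajBound D hNW A (off + (k + dd k)) gs (placeGate (e.trans (Fin.castLEEmb hNW)) (oracleGate A k) *ᵥ ψ)

/-- The trajectory error of tidy blocks is below the tidy trajectory bound (clean inputs stay clean
along the ideal run). [cite: BennettBernsteinBrassardVazirani1997, Thm. 4.14] -/
theorem trajErr_tidy_le {dd : ℕ → ℕ} (D : (k : ℕ) → QCircuit cliffordT (k + dd k)) (hD : ∀ k, (D k).IsOracleFree)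
    (hNW : N ≤ W) (A A' : Language Bool) :
    ∀ (gs : List (QGate cliffordT N)) (off : ℕ), N ≤ off → off + extra (tidyImpl D) gs ≤ W →
      ∀ ψ : QReg W → ℂ, SuppIn (CleanAbove N W) ψ →
        trajErr (tidyImpl D) hNW A A' off gs ψ ≤ tidyTrajBound D hNW A off gs ψ
  | [], _, _, _, _, _ => le_rfl
  | QGate.gate s e :: gs, off, hoff, hW, ψ, hψ => by
    simp only [trajErr, tidyTrajBound]
    exact trajErr_tidy_le D hD hNW A A' gs off hoff hW _ (preservesSupp_cleanAbove_placeGate hNW e _ ψ hψ)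
  | QGate.oracle k e :: gs, off, hoff, hW, ψ, hψ => by
    have hW' : off + (k + dd k + extra (tidyImpl D) gs) ≤ W := by
      have h := hW
      simp only [extra] at h
      exact h
    have hfit : N ≤ off ∧ off + (k + dd k) ≤ W := ⟨hoff, by omega⟩
    simp only [trajErr, tidyTrajBound, dif_pos hfit]
    exact add_le_add (blockErr_tidy_le D hD hNW A A' e hoff hfit.2 ψ hψ)
      (trajErr_tidy_le D hD hNW A A' gs _ (by change N ≤ off + (k + dd k); omega) (by change off + (k + dd k) + _ ≤ W; omega) _
        (preservesSupp_cleanAbove_placeGate hNW e _ ψ hψ))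

/-- **Substituting the tidy blocks of deciders: the error is the sum over the oracle gates of
`2√(Σ_q ε_t(q)·w_t(q))`**, `ε_t(q)` the error probability of the decider on the query `q` and `w_t(q)`
the weight of `q` in the ideal run at that gate — for ALL error profiles at once, in particular for
deciders that are good only on the queries actually asked.
[cite: BennettBernsteinBrassardVazirani1997, Thm. 3.3 (proof), Thm. 4.14, Cor. 4.15] -/
theorem l2Norm_substGates_tidy_sub_le {dd : ℕ → ℕ} (D : (k : ℕ) → QCircuit cliffordT (k + dd k))
    (hD : ∀ k, (D k).IsOracleFree) (hNW : N ≤ W) (A A' : Language Bool) (gs : List (QGate cliffordT N)) (off : ℕ)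
    (hoff : N ≤ off) (hW : off + extra (tidyImpl D) gs ≤ W) (ψ : QReg W → ℂ) (hψ : SuppIn (CleanAbove N W) ψ) :
    l2Norm ((⟨substGates (tidyImpl D) hNW off gs⟩ : QCircuit cliffordT W).toMatrix A' *ᵥ ψ -
      placeGate (Fin.castLEEmb hNW) ((⟨gs⟩ : QCircuit cliffordT N).toMatrix A) *ᵥ ψ) ≤ tidyTrajBound D hNW A off gs ψ :=
  (l2Norm_substGates_sub_le cliffordT_isUnitary_holds (tidyImpl D) hNW A A' gs off hoff hW ψ hψ).trans
    (trajErr_tidy_le D hD hNW A A' gs off hoff hW ψ hψ)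

end Tidy

end OracleImpl

end Literature.Computability.QuantumComplexity

end
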